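import Summits.HodgeConjecture.HodgeConjecture.Theorems.NikulinTwinTransportTwinTwistorTransportTwistorReachChain
import Summits.HodgeConjecture.HodgeConjecture.Theorems.NikulinTwinTransportTwinTwistorTransportMukaiLiftDefs
import Literature.AlgebraicGeometry.Surfaces.K3TwistorLines
import Literature.AlgebraicGeometry.Surfaces.K3PeriodSurjectivityProofs

/-!
# Crux `NikulinTwinTransport.TwinTwistorTransport` (stmt-HodgeConjecture-14393), line
# `mukai-lift-full-similitude`, stub `TwistorReach` — part C: transport to the Mukai-lift lattice
# `(L, q₂) = Λ_{K3} ⊕ ⟨−2⟩`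

Stub 4 of the checked skeleton `Cruxes/TwinTwistorTransport/Lines/mukai_lift_full_similitude.lean`
(vocabulary `LiftLat`, `liftForm`, `liftPeriodDomain`, `IsLiftPositiveThreeSpace`,
`IsLiftGenericThreeSpace`, `liftTwistorLine`, `OnCommonGenericLiftLine`, `ofZL`, `ofRL`, `reL`,
`imL` of `Theorems/NikulinTwinTransportTwinTwistorTransportMukaiLiftDefs`): Huybrechts,
*Lectures on K3 Surfaces*, Ch. 7 Prop. 3.2 ("Any two points `x, y ∈ D` are equivalent", i.e.
joined by a finite chain of GENERIC twistor lines) for the period domain of the lattice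
`(L, q₂) = Λ_{K3} ⊕ ⟨−2⟩` of signature `(3, 20)` — the marked Beauville–Bogomolov lattice of
`K3^{[2]}`-type.

Parts A/B/B2 (`…TwistorReachAlgebra`, `…TwistorReachLattice`, `…TwistorReachChain`) prove the
connectivity `lattice_periodDomain_twistorConnected` for EVERY symmetric integral Gram matrix `G` on
a finite index type with `det G ≠ 0` and a positive triple. Here (part C) it is instantiated with
the index type `K3Index ⊕ Unit` and the block Gram matrix `G_L = k3Gram ⊕ (−2)`
(`det G_L = (−1)·(−2) = 2 ≠ 0` by `k3Gram_det`; symmetric by `k3Gram_apply_comm`; positive triple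
= the K3 one of `exists_k3_generic_posFamily` extended by `0`), and transported along the
coordinate identifications `(K3Index ⊕ Unit → ℂ) = Λ_ℂ ⊕ ℂδ = LiftLat` and
`e_ℝ : (K3Index ⊕ Unit → ℝ) ≃ₗ[ℝ] Λ_ℝ ⊕ ℝδ`: the complex form of `G_L` IS `liftForm 2`
(`liftCF_eq_liftForm`), real / imaginary parts and complex conjugation commute with the
identification, a positive (resp. generic) three-space `W ⊂ ℝ^{K3Index ⊕ Unit}` maps to the
positive (resp. generic) three-space `e_ℝ(W)`, every elementary step maps to an elementary step,
and chains map to chains (induction on `Relation.ReflTransGen`).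

Main result: `TwistorReach` (registered stub statement, verbatim) via
`liftPeriodDomain_twistorConnected`.

References: [Huybrechts2016K3] Ch. 6 §1.1, Prop. 1.5; Ch. 7 §3.1 Def. 3.1, Prop. 3.2 (after
Beauville, Astérisque 126 (1985) Exp. VIII); [Beauville1983] §6, §9 (`H²(S^{[2]}, ℤ) = Λ ⊕ ℤδ`,
`q(δ) = −2`); [Markman2024] Def. 5.13 (generic twistor paths).
-/

-- `Summit.HodgeConjecture.HodgeConjecture.…` (summit = problem) duplicates a namespace component by design (D-0017).
set_option linter.dupNamespace false

noncomputable section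

namespace Summit.HodgeConjecture.HodgeConjecture.Theorems.TwinTwistorTransport.MukaiLift

open scoped BigOperators
open Literature.AlgebraicGeometry.Surfaces

/-- The complex bilinear form `(a.b) = Σᵢⱼ aᵢ Gᵢⱼ bⱼ` of the Gram matrix `G` on `Λ_ℂ = ι → ℂ`. -/
local notation3 (prettyPrint := false) "CF[" G "](" a ", " b ")" =>
  ∑ i, ∑ j, (a : _ → ℂ) i * (((G : Matrix _ _ ℤ) i j : ℤ) : ℂ) * (b : _ → ℂ) j

/-- The real bilinear form of `G` on `Λ_ℝ = ι → ℝ` (Mathlib's `Matrix.toBilin'`). -/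
local notation3 (prettyPrint := false) "RB[" G "]" =>
  Matrix.toBilin' (Matrix.map (G : Matrix _ _ ℤ) (Int.cast : ℤ → ℝ))

/-- `PosThree[G] W`: `W ⊂ Λ_ℝ` is a positive three-space (dimension `3`, the complex form has
positive real part on the non-zero real vectors of `W`) — the shape of `IsPositiveThreeSpace`. -/
local notation3 (prettyPrint := false) "PosThree[" G "](" W ")" =>
  (Module.finrank ℝ (W : Submodule ℝ (_ → ℝ)) = 3 ∧
    ∀ w ∈ (W : Submodule ℝ (_ → ℝ)), w ≠ 0 →
      0 < (∑ i, ∑ j, (fun i => ((w : _ → ℝ) i : ℂ)) i * (((G : Matrix _ _ ℤ) i j : ℤ) : ℂ) *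
        (fun i => ((w : _ → ℝ) i : ℂ)) j).re)

/-- `GenThree[G] W`: no non-zero lattice vector is orthogonal to `W` — the shape of
`IsGenericThreeSpace`. -/
local notation3 (prettyPrint := false) "GenThree[" G "](" W ")" =>
  (∀ v : _ → ℤ, (∀ w ∈ (W : Submodule ℝ (_ → ℝ)),
      ∑ i, ∑ j, (fun i => ((v i : ℤ) : ℂ)) i * (((G : Matrix _ _ ℤ) i j : ℤ) : ℂ) *
        (fun i => ((w : _ → ℝ) i : ℂ)) j = 0) → v = 0)

/-- `x ∈ TwLine[G] W`: `x` is a period point with `Re x, Im x ∈ W` — the shape of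
`k3TwistorLine`. -/
local notation3 (prettyPrint := false) "TwLine[" G "](" W ")" =>
  {x : _ → ℂ | (CF[G](x, x) = 0 ∧ 0 < (CF[G](star x, x)).re) ∧
    (fun i => (x i).re) ∈ (W : Submodule ℝ (_ → ℝ)) ∧
      (fun i => (x i).im) ∈ (W : Submodule ℝ (_ → ℝ))}

/-- `Step[G] x y`: `x` and `y` lie on a common GENERIC twistor line — the shape of
`OnCommonGenericTwistorLine`. -/
local notation3 (prettyPrint := false) "Step[" G "]" =>
  fun (x y : _ → ℂ) => ∃ W : Submodule ℝ (_ → ℝ),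
    PosThree[G](W) ∧ GenThree[G](W) ∧ x ∈ TwLine[G](W) ∧ y ∈ TwLine[G](W)

/-! ### The Mukai-lift lattice `Λ_{K3} ⊕ ⟨−2⟩` as an integral Gram matrix on `K3Index ⊕ Unit` -/

/-- `G_L = k3Gram ⊕ (−2)`: the Gram matrix of `(L, q₂) = Λ_{K3} ⊕ ⟨−2⟩` (Beauville–Bogomolov
lattice of `K3^{[2]}`-type, `q(δ) = −2`) in the basis indexed by `K3Index ⊕ Unit`. -/
local notation3 (prettyPrint := false) "GL" =>
  (Matrix.fromBlocks k3Gram 0 0 (Matrix.of fun (_ : Unit) (_ : Unit) => (-2 : ℤ)) :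
    Matrix (K3Index ⊕ Unit) (K3Index ⊕ Unit) ℤ)

/-- `toL(x)`: the vector of `L = Λ_ℂ ⊕ ℂδ = LiftLat` with coordinates `x : K3Index ⊕ Unit → ℂ`. -/
local notation3 (prettyPrint := false) "toL(" x ")" =>
  ((fun i => (x : K3Index ⊕ Unit → ℂ) (Sum.inl i), (x : K3Index ⊕ Unit → ℂ) (Sum.inr ())) : LiftLat)

/-- `ofL(u)`: the coordinates `K3Index ⊕ Unit → ℂ` of a vector `u ∈ L`. -/
local notation3 (prettyPrint := false) "ofL(" u ")" =>
  (Sum.elim (u : LiftLat).1 (fun _ => (u : LiftLat).2) : K3Index ⊕ Unit → ℂ)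

/-- `eR`: the real coordinate identification `(K3Index ⊕ Unit → ℝ) ≃ₗ[ℝ] Λ_ℝ ⊕ ℝδ`. -/
local notation3 (prettyPrint := false) "eR" =>
  ((LinearEquiv.sumArrowLequivProdArrow K3Index Unit ℝ ℝ).trans
    (LinearEquiv.prodCongr (LinearEquiv.refl ℝ (K3Index → ℝ)) (LinearEquiv.funUnique Unit ℝ ℝ)) :
    (K3Index ⊕ Unit → ℝ) ≃ₗ[ℝ] (K3Index → ℝ) × ℝ)

/-- The Gram matrix `k3Gram ⊕ (−2)` is symmetric. [folklore] -/
theorem liftGram_symm : ∀ i j : K3Index ⊕ Unit, GL i j = GL j i := by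
  rintro (a | u) (b | u')
  · exact k3Gram_apply_comm a b
  · rfl
  · rfl
  · rfl

/-- `det (k3Gram ⊕ (−2)) = (−1)·(−2) = 2`: the lattice `Λ_{K3} ⊕ ⟨−2⟩` is non-degenerate (of
discriminant `2`). [cite: Beauville1983, §9] -/
theorem liftGram_det : Matrix.det GL = 2 := by
  rw [Matrix.det_fromBlocks_zero₂₁, k3Gram_det, Matrix.det_unique, Matrix.of_apply]
  norm_num

/-- The lattice `Λ_{K3} ⊕ ⟨−2⟩` is non-degenerate. [cite: Beauville1983, §9] -/
theorem liftGram_det_ne_zero : Matrix.det GL ≠ 0 := by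
  rw [liftGram_det]
  norm_num

/-- The real form of `G_L` on vectors with vanishing `δ`-coordinate is the real K3 form.
[folklore] -/
theorem liftRB_elim_zero (u w : K3Index → ℝ) :
    RB[GL] (Sum.elim u 0) (Sum.elim w 0) = Matrix.toBilin' (k3Gram.map (Int.cast : ℤ → ℝ)) u w := by
  rw [latticeRB_apply, k3RForm_apply]
  simp [Fintype.sum_sum_type]

/-- **A positive triple for `Λ_{K3} ⊕ ⟨−2⟩`**: the positive triple of `Λ_{K3,ℝ}` (inside `U^{⊕3}`,
`n₊ = 3`) extended by `0` on `δ`. [cite: Huybrechts2016K3, Ch. 7 §3.1 and Ch. 14 §0.3 (vi)] -/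
theorem liftGram_posFamily : ∃ t : Fin 3 → K3Index ⊕ Unit → ℝ, ∀ c : Fin 3 → ℝ, c ≠ 0 →
    0 < RB[GL] (∑ i, c i • t i) (∑ i, c i • t i) := by
  obtain ⟨t, ht, -⟩ := exists_k3_generic_posFamily rfl
  refine ⟨fun k => Sum.elim (t k) 0, fun c hc => ?_⟩
  have hsum : (∑ i, c i • (Sum.elim (t i) (0 : Unit → ℝ))) = Sum.elim (∑ i, c i • t i) 0 := by
    ext (a | u) <;> simp [Finset.sum_apply]
  rw [hsum, liftRB_elim_zero]
  exact ht c hc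

/-! ### The complex form of `G_L` is `liftForm 2`; conjugation, real and imaginary parts -/

/-- **The complex form of `k3Gram ⊕ (−2)` in coordinates is the Beauville–Bogomolov form
`q₂((u, a), (v, b)) = (u.v) − 2ab` of `LiftLat`.** [cite: Beauville1983, §9] -/
theorem liftCF_eq_liftForm (x y : K3Index ⊕ Unit → ℂ) :
    CF[GL](x, y) = liftForm 2 (toL(x)) (toL(y)) := by
  simp only [Fintype.sum_sum_type, Fintype.sum_unique, Matrix.fromBlocks_apply₁₁,
    Matrix.fromBlocks_apply₁₂, Matrix.fromBlocks_apply₂₁, Matrix.fromBlocks_apply₂₂,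
    Matrix.zero_apply, Matrix.of_apply, Int.cast_zero, mul_zero, zero_mul,
    Finset.sum_const_zero, add_zero, zero_add, liftForm, k3Form, PUnit.default_eq_unit]
  push_cast
  ring

/-- Complex conjugation commutes with the coordinate identification. [folklore] -/
theorem toL_star (x : K3Index ⊕ Unit → ℂ) : toL(star x) = star (toL(x)) := rfl

/-- The coordinate identification is a left inverse of taking coordinates. [folklore] -/
theorem toL_ofL (u : LiftLat) : toL(ofL(u)) = u := rfl

/-- Unfolding of the real coordinate identification. [folklore] -/
theorem liftER_apply (w : K3Index ⊕ Unit → ℝ) :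
    eR w = (fun i => w (Sum.inl i), w (Sum.inr ())) := rfl

/-- Real vectors: `ofRL ∘ e_ℝ` is the coordinate identification of the complexified vector.
[folklore] -/
theorem ofRL_liftER (w : K3Index ⊕ Unit → ℝ) : ofRL (eR w) = toL(fun i => ((w i : ℝ) : ℂ)) := rfl

/-- Lattice vectors: `ofZL v k` is the coordinate identification of the integral vector
`Sum.elim v k`. [folklore] -/
theorem ofZL_eq_toL (v : K3Index → ℤ) (k : ℤ) :
    ofZL v k = toL(fun i => ((Sum.elim v (fun _ : Unit => k) i : ℤ) : ℂ)) := rfl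

/-- Real parts commute with the coordinate identification. [folklore] -/
theorem reL_toL (x : K3Index ⊕ Unit → ℂ) : reL (toL(x)) = eR (fun i => (x i).re) := rfl

/-- Imaginary parts commute with the coordinate identification. [folklore] -/
theorem imL_toL (x : K3Index ⊕ Unit → ℂ) : imL (toL(x)) = eR (fun i => (x i).im) := rfl

/-! ### Period points, positive / generic three-spaces, twistor lines and steps transport -/

/-- A vector of `L` is a period point of `(L, q₂)` iff its coordinates form a period point of
`G_L`. [cite: Huybrechts2016K3, Ch. 6 §1.1] -/
theorem toL_mem_liftPeriodDomain_iff (x : K3Index ⊕ Unit → ℂ) :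
    toL(x) ∈ liftPeriodDomain 2 ↔ CF[GL](x, x) = 0 ∧ 0 < (CF[GL](star x, x)).re := by
  rw [liftCF_eq_liftForm, liftCF_eq_liftForm, toL_star]
  exact Iff.rfl

/-- The coordinates of a period point of `(L, q₂)` form a period point of `G_L`.
[cite: Huybrechts2016K3, Ch. 6 §1.1] -/
theorem liftPeriod_ofL {u : LiftLat} (hu : u ∈ liftPeriodDomain 2) :
    CF[GL](ofL(u), ofL(u)) = 0 ∧ 0 < (CF[GL](star (ofL(u)), ofL(u))).re :=
  (toL_mem_liftPeriodDomain_iff (ofL(u))).1 hu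

/-- A positive three-space of `G_L` maps to a positive three-space of `(L, q₂)`.
[cite: Huybrechts2016K3, Ch. 7 §3.1] -/
theorem isLiftPositiveThreeSpace_map {W : Submodule ℝ (K3Index ⊕ Unit → ℝ)} (hW : PosThree[GL](W)) :
    IsLiftPositiveThreeSpace 2 (W.map (LinearEquiv.toLinearMap eR)) := by
  refine ⟨(LinearEquiv.finrank_map_eq _ W).trans hW.1, ?_⟩
  rintro _ ⟨w, hw, rfl⟩ hne
  have hw0 : w ≠ 0 := by
    rintro rfl
    exact hne (map_zero _)
  have h := hW.2 w hw hw0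
  rwa [liftCF_eq_liftForm, ← ofRL_liftER] at h

/-- A generic three-space of `G_L` maps to a generic three-space of `(L, q₂)`
(`W^⊥ ∩ (Λ ⊕ ℤδ) = 0`). [cite: Huybrechts2016K3, Ch. 7 §3.1] -/
theorem isLiftGenericThreeSpace_map {W : Submodule ℝ (K3Index ⊕ Unit → ℝ)} (hW : GenThree[GL](W)) :
    IsLiftGenericThreeSpace 2 (W.map (LinearEquiv.toLinearMap eR)) := by
  intro v k h
  have hv : Sum.elim v (fun _ : Unit => k) = 0 := by
    refine hW _ fun w hw => ?_
    rw [liftCF_eq_liftForm, ← ofZL_eq_toL, ← ofRL_liftER]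
    exact h _ (Submodule.mem_map_of_mem hw)
  exact ⟨funext fun i => congrFun hv (Sum.inl i), congrFun hv (Sum.inr ())⟩

/-- A point of the twistor line `T_W` of `G_L` maps to a point of the twistor line `T_{e_ℝ W}` of
`(L, q₂)`. [cite: Huybrechts2016K3, Ch. 7 §3.1] -/
theorem toL_mem_liftTwistorLine {W : Submodule ℝ (K3Index ⊕ Unit → ℝ)} {x : K3Index ⊕ Unit → ℂ}
    (hx : x ∈ TwLine[GL](W)) : toL(x) ∈ liftTwistorLine 2 (W.map (LinearEquiv.toLinearMap eR)) := by
  refine ⟨(toL_mem_liftPeriodDomain_iff x).2 hx.1, ?_, ?_⟩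
  · rw [reL_toL]
    exact Submodule.mem_map_of_mem hx.2.1
  · rw [imL_toL]
    exact Submodule.mem_map_of_mem hx.2.2

/-- An elementary step of `G_L` (two points on a common generic twistor line) maps to an
elementary step `OnCommonGenericLiftLine 2` of `(L, q₂)`.
[cite: Huybrechts2016K3, Ch. 7 §3.1 Def. 3.1] -/
theorem onCommonGenericLiftLine_toL {x y : K3Index ⊕ Unit → ℂ} (h : (Step[GL]) x y) :
    OnCommonGenericLiftLine 2 (toL(x)) (toL(y)) := by
  obtain ⟨W, hWpos, hWgen, hx, hy⟩ := h
  exact ⟨W.map (LinearEquiv.toLinearMap eR), isLiftPositiveThreeSpace_map hWpos,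
    isLiftGenericThreeSpace_map hWgen, toL_mem_liftTwistorLine hx, toL_mem_liftTwistorLine hy⟩

/-- Chains of generic twistor lines of `G_L` map to chains of generic twistor lines of `(L, q₂)`.
[cite: Huybrechts2016K3, Ch. 7 §3.1 Def. 3.1] -/
theorem liftChain_toL {x y : K3Index ⊕ Unit → ℂ} (h : Relation.ReflTransGen (Step[GL]) x y) :
    Relation.ReflTransGen (OnCommonGenericLiftLine 2) (toL(x)) (toL(y)) := by
  induction h with
  | refl => exact Relation.ReflTransGen.refl
  | tail _ hbc ih => exact ih.tail (onCommonGenericLiftLine_toL hbc)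

/-! ### Huybrechts Ch. 7 Prop. 3.2 for `(L, q₂) = Λ_{K3} ⊕ ⟨−2⟩` -/

/-- **Twistor-line connectivity of the period domain of `(L, q₂) = Λ_{K3} ⊕ ⟨−2⟩`** (Huybrechts,
*Lectures on K3 Surfaces*, Ch. 7 Prop. 3.2, for the lattice `Λ_{K3} ⊕ ⟨−2⟩` of signature
`(3, 20)`): any two period points are joined by a finite chain of GENERIC twistor lines
(`W` positive of dimension `3`, `W^⊥ ∩ (Λ ⊕ ℤδ) = 0`). Instance of
`lattice_periodDomain_twistorConnected` (index type `K3Index ⊕ Unit`, Gram matrix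
`k3Gram ⊕ (−2)`), transported along the coordinate identification.
[cite: Huybrechts2016K3, Ch. 7 §3.1 Prop. 3.2] -/
theorem liftPeriodDomain_twistorConnected {x y : LiftLat} (hx : x ∈ liftPeriodDomain 2)
    (hy : y ∈ liftPeriodDomain 2) : Relation.ReflTransGen (OnCommonGenericLiftLine 2) x y := by
  have h := liftChain_toL (lattice_periodDomain_twistorConnected GL liftGram_symm
    liftGram_det_ne_zero liftGram_posFamily (liftPeriod_ofL hx) (liftPeriod_ofL hy))
  rwa [toL_ofL, toL_ofL] at h

/-- **Stub `TwistorReach` (registered form, verbatim)**: any two points of the period domain of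
`(L, q₂) = Λ_{K3} ⊕ ⟨−2⟩` are joined by a finite chain of generic twistor lines — Huybrechts Ch. 7
Prop. 3.2 for the Mukai-lift lattice; feeds `LiftEngine` with the chain from the anchor's period
`(x₀′, 0)` to `(x′, 0)` in `TwinTwistorTransport_of`.
[cite: Huybrechts2016K3, Ch. 7 §3.1 Prop. 3.2] -/
theorem TwistorReach : ∀ x ∈ liftPeriodDomain 2, ∀ y ∈ liftPeriodDomain 2, Relation.ReflTransGen (OnCommonGenericLiftLine 2) x y :=
  fun _ hx _ hy => liftPeriodDomain_twistorConnected hx hy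

end Summit.HodgeConjecture.HodgeConjecture.Theorems.TwinTwistorTransport.MukaiLift

end
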